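import Literature.Geometry.Riemannian.NormalJacobiTensorExplicit
import Literature.Geometry.Riemannian.ExpMapGramDeterminant
import Literature.Geometry.Riemannian.JacobianChartFormula
import Literature.Geometry.Riemannian.BonnetMyers
import Literature.Geometry.Riemannian.CutLocusBishopExp
import HarnessLib

/-!
# Bishop's comparison theorem for the Gram–Jacobian of `exp_p` under `Ric ≥ 0`

Let `(M, g)` be a connected Riemannian `m`-manifold modelled on `ℝᵐ = EuclideanSpace ℝ (Fin m)`
whose closed distance balls are compact (so that the Levi-Civita connection is geodesically
complete, `isGeodesicallyComplete_of_isCompact_closedBall`), with `Ric ≥ 0`. For `p ∈ M` and a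
`C¹` map `F : ℝᵐ = T_pM → M` the **Gram–Jacobian** of `F` at `u` is
`𝒥_F(u) = √(det (g(DF(u) eᵢ, DF(u) eⱼ))ᵢⱼ)`, `eᵢ` the standard basis. The main result
`antitoneOn_jacobian_expMap_of_ricci_nonneg` is the radial monotonicity of the Gram–Jacobian of
`F = exp_p` along minimizing directions: if `γ_v|[0, 1]` is minimizing (`IsMinimizingUpTo`), then
`s ↦ 𝒥_{exp_p}(s v)` is non-increasing on `(0, 1]` — Bishop's comparison theorem
(Chavel 2006, Thm. III.4.3 with `κ = 0`; Lee 2018, Thm. 11.19) read through the exponential map,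
the curvature input of Calabi–Yau's "complete + `Ric ≥ 0` ⇒ infinite volume" (Yau 1976) in its
Bishop–Gromov-by-homothety form.

Proof. Reduce to the `g`-unit vector `u = v/|v|` on `(0, ℓ]`, `ℓ = |v|_g`. Along `γ_u` take a
full parallel orthonormal frame headed by `γ̇_u` (`exists_fullFrame_along_maximalGeodesic`); the
normal Jacobi tensor `A(t)` of Chavel's Thm. III.4.3 in this frame
(`normalJacobiTensor_frame_explicit`) satisfies the matrix Jacobi equation with `tr R = Ric ≥ 0`,
and `det A ≠ 0` on `(0, ℓ)` because minimizing segments have no interior conjugate points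
(`mfderiv_riemannianExpMap_injective_of_mem_injectivityDomain`); hence `det A(t)/t^{m-1}` is
positive and non-increasing on `(0, ℓ)` (`jacobi_det_pos`, `jacobi_det_div_pow_antitoneOn`), and
by continuity of `A` at `ℓ` also on `(0, ℓ]`. The Gram determinant of `d(exp_p)_{tu}` on the
frame at `p` is `det A(t)² / t^{2(m-1)}` (`det_gram_mfderiv_expMap_frame`), and the Gram
determinant on the standard basis differs from it by a positive constant independent of `t`
(change of basis, `sqrt_det_gram_bilin_comp`).

No definitions, no named facts.

## References

* I. Chavel, *Riemannian Geometry: A Modern Introduction*, 2nd ed., CUP 2006, §III.4,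
  Thm. III.4.3 and Prop. III.4.1. [Chavel2006]
* J. M. Lee, *Introduction to Riemannian Manifolds*, 2nd ed., Springer 2018, Thm. 10.26,
  Thm. 11.19. [LeeRiemannianManifolds2018]
* S.-T. Yau, *Some function-theoretic properties of complete Riemannian manifolds and their
  applications to geometry*, Indiana Univ. Math. J. 25 (1976) 659–670. [Yau1976]
-/

noncomputable section

open Bundle Set Function Filter Manifold
open scoped Manifold ContDiff Topology NNReal

namespace Literature.Geometry.Riemannian

open Lorentzian Lorentzian.PseudoRiemannianMetric

/-! ### Elementary lemmas: one real variable, Gram determinants in two bases -/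

section Elementary

/-- An antitone function on `(a, ℓ)` which is continuous from the left at `ℓ` is antitone on
`(a, ℓ]`. [folklore] -/
theorem antitoneOn_Ioc_of_antitoneOn_Ioo {φ : ℝ → ℝ} {a ℓ : ℝ} (hanti : AntitoneOn φ (Ioo a ℓ))
    (hcont : ContinuousWithinAt φ (Iio ℓ) ℓ) : AntitoneOn φ (Ioc a ℓ) := by
  intro s hs t ht hst
  rcases ht.2.lt_or_eq with htl | htl
  · exact hanti ⟨hs.1, hst.trans_lt htl⟩ ⟨ht.1, htl⟩ hst
  rw [htl]
  rcases (hst.trans_eq htl).lt_or_eq with hsl | hsl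
  · have hev : ∀ᶠ r in 𝓝[<] ℓ, φ r ≤ φ s :=
      eventually_of_mem (Ioo_mem_nhdsLT hsl) fun r hr ↦
        hanti ⟨hs.1, hsl⟩ ⟨hs.1.trans hr.1, hr.2⟩ hr.1.le
    exact le_of_tendsto hcont.tendsto hev
  · rw [hsl]

/-- **Bishop's monotone quantity without the dimension restriction**: the conclusion of
`jacobi_det_div_pow_antitoneOn` (`det 𝒜 / t^{n-1}` non-increasing on `(0, b)`, Chavel 2006,
Thm. III.4.3, `κ = 0`) also for an empty index type, where `det 𝒜 / t⁰ ≡ 1`.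
[cite: Chavel2006, Thm. III.4.3 and Prop. III.4.1] -/
theorem jacobi_det_div_pow_antitoneOn' {ι : Type*} [Fintype ι] [DecidableEq ι]
    {A A' R : ℝ → Matrix ι ι ℝ} {a b : ℝ} (h0 : (0 : ℝ) ∈ Ioo a b)
    (hA : ∀ t ∈ Ioo a b, HasDerivAt A (A' t) t)
    (hA' : ∀ t ∈ Ioo a b, HasDerivAt A' (-(R t * A t)) t)
    (hR : ∀ t ∈ Ioo a b, (R t).IsSymm) (hRc : ContinuousAt R 0)
    (hA0 : A 0 = 0) (hA'0 : A' 0 = 1)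
    (hdet : ∀ t ∈ Ioo 0 b, (A t).det ≠ 0)
    (hRic : ∀ t ∈ Ioo 0 b, 0 ≤ (R t).trace) :
    AntitoneOn (fun t ↦ (A t).det / t ^ Fintype.card ι) (Ioo 0 b) := by
  rcases isEmpty_or_nonempty ι with hι | hι
  · intro s _ t _ _
    simp [Matrix.det_isEmpty]
  · exact jacobi_det_div_pow_antitoneOn h0 hA hA' hR hRc hA0 hA'0 hdet hRic

/-- If `t ↦ det A(t) / t^N` (`N = card ι`) is antitone on `(0, ℓ)` with `det A > 0` there and
`A` continuous at `ℓ`, and `det G(t) · t^{2N} = det A(t)²` on `(0, ℓ]`, then `t ↦ √(det G(t))`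
is antitone on `(0, ℓ]`: on `(0, ℓ]`, `√(det G) = |det A / t^N| = det A / t^N`, the endpoint
being reached by continuity (Chavel 2006, proof of Thm. III.4.3: `√g(t;ξ) = det 𝒜(t;ξ)/t^{n-1}`).
[folklore] -/
theorem antitoneOn_sqrt_det_of_mul_pow_eq_sq {ι κ : Type*} [Fintype ι] [DecidableEq ι]
    [Fintype κ] [DecidableEq κ] {A : ℝ → Matrix ι ι ℝ} {G : ℝ → Matrix κ κ ℝ} {ℓ : ℝ}
    (hpos : ∀ t ∈ Ioo 0 ℓ, 0 < (A t).det) (hcont : ContinuousAt A ℓ)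
    (hgram : ∀ t ∈ Ioc 0 ℓ, (G t).det * t ^ (2 * Fintype.card ι) = (A t).det ^ 2)
    (hanti : AntitoneOn (fun t ↦ (A t).det / t ^ Fintype.card ι) (Ioo 0 ℓ)) :
    AntitoneOn (fun t ↦ Real.sqrt (G t).det) (Ioc 0 ℓ) := by
  set φ : ℝ → ℝ := fun t ↦ (A t).det / t ^ Fintype.card ι
  -- on `(0, ℓ]`, `√(det G) = |φ|`
  have hsqrt : ∀ t ∈ Ioc 0 ℓ, Real.sqrt (G t).det = |φ t| := by
    intro t ht
    have hG : (G t).det = φ t ^ 2 := by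
      show (G t).det = ((A t).det / t ^ Fintype.card ι) ^ 2
      rw [div_pow, ← pow_mul, eq_div_iff (pow_ne_zero _ ht.1.ne'), mul_comm (Fintype.card ι) 2]
      exact hgram t ht
    rw [hG, Real.sqrt_sq_eq_abs]
  rcases le_or_gt ℓ 0 with hℓ | hℓ
  · intro s hs t _ _
    exact absurd (hs.1.trans_le (hs.2.trans hℓ)) (lt_irrefl _)
  -- `φ` is continuous at `ℓ`, antitone and nonnegative on `(0, ℓ]`
  have hφc : ContinuousAt φ ℓ := by
    have hdetc : Continuous fun B : Matrix ι ι ℝ ↦ B.det := continuous_id.matrix_det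
    exact (hdetc.continuousAt.comp hcont).div (continuousAt_id.pow _) (pow_ne_zero _ hℓ.ne')
  have hφanti : AntitoneOn φ (Ioc 0 ℓ) :=
    antitoneOn_Ioc_of_antitoneOn_Ioo hanti hφc.continuousWithinAt
  have hφpos : ∀ t ∈ Ioo 0 ℓ, 0 ≤ φ t := fun t ht ↦
    (div_pos (hpos t ht) (pow_pos ht.1 _)).le
  have hφℓ : 0 ≤ φ ℓ :=
    ge_of_tendsto (hφc.tendsto.mono_left (nhdsWithin_le_nhds (s := Iio ℓ)))
      (eventually_of_mem (Ioo_mem_nhdsLT hℓ) fun r hr ↦ hφpos r hr)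
  have hφnn : ∀ t ∈ Ioc 0 ℓ, 0 ≤ φ t := by
    intro t ht
    rcases ht.2.lt_or_eq with htl | htl
    · exact hφpos t ⟨ht.1, htl⟩
    · rw [htl]; exact hφℓ
  intro s hs t ht hst
  show Real.sqrt (G t).det ≤ Real.sqrt (G s).det
  rw [hsqrt t ht, hsqrt s hs, abs_of_nonneg (hφnn t ht), abs_of_nonneg (hφnn s hs)]
  exact hφanti hs ht hst

/-- **Gram determinants in two bases differ by a positive constant**: for a basis `b` of a
finite-dimensional real vector space `V` and a linearly independent family `x` of `dim V`
vectors there is `C > 0` with `√(det (B(bᵢ, bⱼ))) = C √(det (B(x_o, x_{o'})))` for every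
bilinear form `B` on `V` (`C = |det L|⁻¹` for the automorphism `L` with `L bᵢ = x_{σ i}`,
`σ : ι ≃ κ`; `sqrt_det_gram_bilin_comp`). [folklore] -/
theorem exists_sqrt_det_gram_eq_mul_sqrt_det_gram {V : Type*} [AddCommGroup V] [Module ℝ V]
    [FiniteDimensional ℝ V] {ι κ : Type*} [Fintype ι] [DecidableEq ι] [Fintype κ]
    [DecidableEq κ] (b : Module.Basis ι ℝ V) {x : κ → V} (hx : LinearIndependent ℝ x)
    (hcard : Fintype.card κ = Module.finrank ℝ V) :
    ∃ C : ℝ, 0 < C ∧ ∀ B : LinearMap.BilinForm ℝ V,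
      Real.sqrt (Matrix.of fun i j ↦ B (b i) (b j)).det =
        C * Real.sqrt (Matrix.of fun o o' ↦ B (x o) (x o')).det := by
  set bx : Module.Basis κ ℝ V := basisOfLinearIndependentOfCardEqFinrank' x hx hcard
  have hbx : ∀ o, bx o = x o := fun o ↦
    congrFun (coe_basisOfLinearIndependentOfCardEqFinrank' x hx hcard) o
  set σ : ι ≃ κ := b.indexEquiv bx
  set e : V ≃ₗ[ℝ] V := b.equiv bx σ with he_def
  have he : ∀ i, e (b i) = x (σ i) := fun i ↦ by rw [he_def, Module.Basis.equiv_apply, hbx]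
  have hdet : LinearMap.det (e : V →ₗ[ℝ] V) ≠ 0 := e.isUnit_det'.ne_zero
  refine ⟨|LinearMap.det (e : V →ₗ[ℝ] V)|⁻¹, inv_pos.2 (abs_pos.2 hdet), fun B ↦ ?_⟩
  have h1 := sqrt_det_gram_bilin_comp b B (e : V →ₗ[ℝ] V)
  have h2 : (Matrix.of fun i j ↦ B ((e : V →ₗ[ℝ] V) (b i)) ((e : V →ₗ[ℝ] V) (b j))) =
      (Matrix.of fun o o' ↦ B (x o) (x o')).submatrix σ σ := by
    ext i j
    simp only [Matrix.of_apply, Matrix.submatrix_apply, LinearEquiv.coe_coe, he]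
  rw [h2, Matrix.det_submatrix_equiv_self] at h1
  rw [h1, ← mul_assoc, inv_mul_cancel₀ (abs_ne_zero.2 hdet), one_mul]

end Elementary

/-! ### Bishop's comparison along a minimizing unit-speed geodesic -/

section UnitSpeed

variable {E : Type*} [NormedAddCommGroup E] [NormedSpace ℝ E] [FiniteDimensional ℝ E]
  [CompleteSpace E] {M : Type*} [TopologicalSpace M] [ChartedSpace E M] [IsManifold 𝓘(ℝ, E) ∞ M]
  [T2Space M]
  (g : PseudoRiemannianMetric 𝓘(ℝ, E) ∞ E (TangentSpace 𝓘(ℝ, E) : M → Type _)) [g.HasLeviCivita]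
  [CovariantDerivative.ContMDiffCovariantDerivative g.leviCivita 1]
  [CovariantDerivative.ContMDiffCovariantDerivative g.leviCivita ∞]

/-- **Bishop's comparison theorem for the Gram–Jacobian of `exp_p`, unit-speed form** (Chavel
2006, Thm. III.4.3 with `κ = 0`; Lee 2018, Thm. 11.19 with Thm. 10.26). For a smooth Riemannian
metric with complete Levi-Civita connection and `Ric ≥ 0`, a `g`-unit vector `u ∈ T_pM` such that
`γ_u|[0, ℓ]` is minimizing (`ℓ > 0`), and any basis `b` of the model space `E = T_pM`, the
Gram–Jacobian `t ↦ √(det (g(d(exp_p)_{tu} bᵢ, d(exp_p)_{tu} bⱼ))ᵢⱼ)` is non-increasing on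
`(0, ℓ]`: in a full parallel orthonormal frame along `γ_u` it equals a positive constant times
`det A(t)/t^{dim M - 1}` (`det_gram_mfderiv_expMap_frame`, change of Gram basis), `A` the normal
Jacobi tensor (`normalJacobiTensor_frame_explicit`), which is positive and non-increasing on
`(0, ℓ)` by the matrix Riccati comparison (`jacobi_det_pos`, `jacobi_det_div_pow_antitoneOn`;
no conjugate points before the cut point,
`mfderiv_riemannianExpMap_injective_of_mem_injectivityDomain`) and continuous at `ℓ`.
[cite: Chavel2006, Thm. III.4.3] -/
theorem antitoneOn_sqrt_det_gram_mfderiv_expMap_of_unit (hg : g.IsRiemannian)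
    (hc : IsGeodesicallyComplete g.leviCivita)
    (hRic : ∀ (x : M) (w : TangentSpace 𝓘(ℝ, E) x), 0 ≤ g.leviCivita.ricci x w w)
    (p : M) (u : E) (hu : g.val p u u = 1) {ℓ : ℝ} (hℓ : 0 < ℓ)
    (hmin : IsMinimizingUpTo g hg p u ℓ) {ι : Type*} [Fintype ι] [DecidableEq ι]
    (b : Module.Basis ι ℝ E) :
    AntitoneOn (fun t : ℝ ↦ Real.sqrt (Matrix.of fun i j ↦
      g.val (expMap g.leviCivita p (t • u))
        (mfderiv 𝓘(ℝ, E) 𝓘(ℝ, E) (fun w : E ↦ expMap g.leviCivita p w) (t • u) (b i))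
        (mfderiv 𝓘(ℝ, E) 𝓘(ℝ, E) (fun w : E ↦ expMap g.leviCivita p w) (t • u) (b j))).det)
      (Ioc 0 ℓ) := by
  have hLC := PseudoRiemannianMetric.isLeviCivita_leviCivita_holds (g := g)
  have hreg : g.leviCivita.IsLocallyContMDiff 1 :=
    hLC.isLocallyContMDiff_one (WithTop.coe_le_coe.mpr le_top)
  have hinf : g.leviCivita.IsLocallyContMDiff (⊤ : ℕ∞) := hLC.isLocallyContMDiff ⊤ (le_of_eq rfl)
  have h2 : (2 : ℕ∞ω) ≤ ∞ := WithTop.coe_le_coe.2 le_top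
  have h0 : (0 : ℝ) ∈ Ioo (-1) (ℓ + 1) := ⟨by norm_num, by linarith⟩
  have h0' : (0 : ℝ) ∈ Ioo (-1) ℓ := ⟨by norm_num, hℓ⟩
  have hsub : ∀ {t : ℝ}, t ∈ Ioo (-1 : ℝ) ℓ → t ∈ Ioo (-1) (ℓ + 1) := fun ht ↦
    ⟨ht.1, ht.2.trans (lt_add_one ℓ)⟩
  have hsub0 : ∀ {t : ℝ}, t ∈ Ioo (0 : ℝ) ℓ → t ∈ Ioo (-1) (ℓ + 1) := fun ht ↦
    ⟨by linarith [ht.1], ht.2.trans (lt_add_one ℓ)⟩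
  have hIoc : ∀ {t : ℝ}, t ∈ Ioc (0 : ℝ) ℓ → t ∈ Ioo (-1) (ℓ + 1) := fun ht ↦
    ⟨by linarith [ht.1], by linarith [ht.2]⟩
  -- a full parallel orthonormal frame along `γ_u` headed by `γ̇_u`, and the matrix Jacobi data
  obtain ⟨k, f, hfnone, hfpar, hon, hcard⟩ :=
    exists_fullFrame_along_maximalGeodesic g hg hc p u hu h0
  obtain ⟨-, hgeo, -, -⟩ := maximalGeodesic_of_isGeodesicallyComplete hc p u
  obtain ⟨hA, hA', hR, htr, hA0, hA'0, hdet, hnormal⟩ :=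
    normalJacobiTensor_frame_explicit g hreg h2 hc p u h0 f hfnone hfpar hon hcard
  have hRc := continuousAt_frameMatrix_curvature g g.leviCivita hreg hinf
    (hgeo.mono (subset_univ _)) hfpar h0
  -- no conjugate points on `(0, ℓ)`: `t u ∈ ID(p)`, as `γ_{tu}` minimises up to `ℓ / t > 1`
  have hinj : ∀ t ∈ Ioo (0 : ℝ) ℓ, Injective (mfderiv 𝓘(ℝ, E) 𝓘(ℝ, E)
      (fun w : E ↦ expMap g.leviCivita p (show TangentSpace 𝓘(ℝ, E) p from w))
      (t • (show E from u))) := by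
    intro t ht
    have ht0 : t ≠ 0 := ht.1.ne'
    have hID : t • u ∈ injectivityDomain g hg p := by
      refine ⟨ℓ / t, (one_lt_div ht.1).2 ht.2, ?_⟩
      refine (isMinimizingUpTo_smul_iff hg hc p u ht.1 (ℓ / t)).2 ?_
      rw [show t * (ℓ / t) = ℓ by field_simp]
      exact hmin
    exact mfderiv_riemannianExpMap_injective_of_mem_injectivityDomain g le_rfl hg hc p hID
  -- Bishop: `det A > 0` and `det A / t^k` non-increasing on `(0, ℓ)`; `A` continuous at `ℓ`
  have hpos := jacobi_det_pos h0' (fun t ht ↦ hA t (hsub ht)) hA0 hA'0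
    (fun t ht ↦ hdet t (hsub0 ht) ht.1.ne' (hinj t ht))
  have hanti := jacobi_det_div_pow_antitoneOn' h0' (fun t ht ↦ hA t (hsub ht))
    (fun t ht ↦ hA' t (hsub ht)) (fun t ht ↦ hR t (hsub ht)) hRc hA0 hA'0
    (fun t ht ↦ hdet t (hsub0 ht) ht.1.ne' (hinj t ht))
    (fun t ht ↦ (hRic _ _).trans_eq (htr t (hsub0 ht)).symm)
  have hAc := (hasDerivAt_iff_hasFDerivAt.1 (hA ℓ ⟨by linarith, lt_add_one ℓ⟩)).continuousAt
  -- the differential `L t = d(exp_p)_{tu}` and the pulled-back metric `g_{γ(t)}(L t ·, L t ·)`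
  set L : ℝ → (E →L[ℝ] E) := fun t ↦
    mfderiv 𝓘(ℝ, E) 𝓘(ℝ, E) (fun w : E ↦ expMap g.leviCivita p w) (t • u)
  set B : ℝ → LinearMap.BilinForm ℝ E := fun t ↦
    LinearMap.BilinForm.comp
      (g.val (maximalGeodesic g.leviCivita p u t) : E →L[ℝ] E →L[ℝ] ℝ).toLinearMap₁₂
      (L t : E →ₗ[ℝ] E) (L t : E →ₗ[ℝ] E)
  have hB_apply : ∀ t y z, B t y z = g.val (maximalGeodesic g.leviCivita p u t) (L t y) (L t z) :=
    fun t y z ↦ rfl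
  -- the frame at `p` is a basis of `T_pM = E`: change of Gram basis
  set x : Option (Fin k) → E := fun o ↦ f 0 o
  have hx : LinearIndependent ℝ x :=
    linearIndependent_of_bilin_orthonormal (V := E) (g.val (maximalGeodesic g.leviCivita p u 0))
      (hon 0 h0)
  obtain ⟨C, hC, hCgram⟩ := exists_sqrt_det_gram_eq_mul_sqrt_det_gram b hx hcard
  have hJac : ∀ t, Real.sqrt (Matrix.of fun i j ↦
      g.val (maximalGeodesic g.leviCivita p u t) (L t (b i)) (L t (b j))).det =
      C * Real.sqrt (Matrix.of fun o o' ↦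
        g.val (maximalGeodesic g.leviCivita p u t) (L t (x o)) (L t (x o'))).det := by
    intro t
    have h := hCgram (B t)
    simp only [hB_apply] at h
    exact h
  -- the Gram determinant on the frame is `det A(t)² / t^{2k}`, hence antitone on `(0, ℓ]`
  have hgram := fun t (ht : t ∈ Ioc (0 : ℝ) ℓ) ↦
    det_gram_mfderiv_expMap_frame g hc p u f hfnone hon hcard hnormal (hIoc ht) ht.1.ne'
  have hGanti : AntitoneOn (fun t ↦ Real.sqrt (Matrix.of fun o o' ↦
      g.val (maximalGeodesic g.leviCivita p u t) (L t (x o)) (L t (x o'))).det) (Ioc 0 ℓ) :=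
    antitoneOn_sqrt_det_of_mul_pow_eq_sq hpos hAc hgram hanti
  -- `exp_p (t u) = γ_u t`
  have hpt : ∀ t : ℝ, expMap g.leviCivita p (t • u) = maximalGeodesic g.leviCivita p u t :=
    fun t ↦ expMap_smul hc p u t
  intro s hs t ht hst
  have key := mul_le_mul_of_nonneg_left (hGanti hs ht hst) hC.le
  rw [← hJac t, ← hJac s] at key
  show Real.sqrt (Matrix.of fun i j ↦ g.val (expMap g.leviCivita p (t • u))
      (L t (b i)) (L t (b j))).det ≤ Real.sqrt (Matrix.of fun i j ↦
        g.val (expMap g.leviCivita p (s • u)) (L s (b i)) (L s (b j))).det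
  rw [hpt t, hpt s]
  exact key

end UnitSpeed

/-! ### The theorem: radial antitonicity of the Gram–Jacobian of `exp_p` -/

section Main

/-- **Bishop's comparison theorem transferred to the exponential map** (Chavel 2006,
Thm. III.4.3, `κ = 0`; Lee 2018, Thm. 11.19; the curvature step of Yau 1976 / Calabi–Yau's
infinite-volume theorem). Let `(M, g)` be a connected Riemannian `m`-manifold modelled on `ℝᵐ`
whose closed `g`-distance balls are compact, with `Ric ≥ 0`, and let `p ∈ M`, `v ∈ T_pM = ℝᵐ`
with `γ_v|[0, 1]` minimizing. Then the Gram–Jacobian of `exp_p` along the ray,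
`s ↦ √(det (g(d(exp_p)_{sv} eᵢ, d(exp_p)_{sv} eⱼ))ᵢⱼ)` (`eᵢ` the standard basis of `ℝᵐ`), is
non-increasing on `(0, 1]`. (For `v = 0` the function is constant; otherwise rescale to the unit
vector `v/|v|_g`, minimizing up to `|v|_g`, and apply
`antitoneOn_sqrt_det_gram_mfderiv_expMap_of_unit`.) [cite: Chavel2006, Thm. III.4.3] -/
theorem antitoneOn_jacobian_expMap_of_ricci_nonneg {m : ℕ} {M : Type*} [TopologicalSpace M]
    [T2Space M] [SecondCountableTopology M] [ChartedSpace (EuclideanSpace ℝ (Fin m)) M]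
    [IsManifold (𝓡 m) ∞ M] [T3Space M] [MeasurableSpace M] [BorelSpace M]
    (g : PseudoRiemannianMetric (𝓡 m) ∞ (EuclideanSpace ℝ (Fin m))
      (TangentSpace (𝓡 m) : M → Type _))
    [ConnectedSpace M] [g.HasLeviCivita] (hg : g.IsRiemannian)
    (hcpl : ∀ (x : M) (r : ℝ≥0), IsCompact {y : M | g.edist hg x y ≤ r})
    (hRic : ∀ (x : M) (w : TangentSpace (𝓡 m) x), 0 ≤ g.ricci x w w)
    (p : M) (v : EuclideanSpace ℝ (Fin m)) (hv : IsMinimizingUpTo g hg p v 1) :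
    AntitoneOn (fun s : ℝ ↦ Real.sqrt (Matrix.det (Matrix.of fun i j : Fin m ↦
      g.val (riemannianExpMap g p (s • v))
        (mfderiv 𝓘(ℝ, EuclideanSpace ℝ (Fin m)) (𝓡 m)
          (fun u : EuclideanSpace ℝ (Fin m) ↦ riemannianExpMap g p u) (s • v)
          (EuclideanSpace.single i (1 : ℝ)))
        (mfderiv 𝓘(ℝ, EuclideanSpace ℝ (Fin m)) (𝓡 m)
          (fun u : EuclideanSpace ℝ (Fin m) ↦ riemannianExpMap g p u) (s • v)
          (EuclideanSpace.single j (1 : ℝ)))))) (Ioc (0 : ℝ) 1) := by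
  -- the Levi-Civita connection of the smooth metric is `C¹` and `C^∞`, and complete
  have hk1 : ((1 : ℕ∞) : ℕ∞ω) + 1 ≤ ∞ := by
    rw [show ((1 : ℕ∞) : ℕ∞ω) + 1 = 2 by norm_num]
    exact WithTop.coe_le_coe.2 le_top
  haveI : CovariantDerivative.ContMDiffCovariantDerivative g.leviCivita 1 :=
    ⟨g.isLocallyContMDiff_leviCivita_holds 1 hk1 univ isOpen_univ⟩
  haveI : CovariantDerivative.ContMDiffCovariantDerivative g.leviCivita ∞ :=
    ⟨g.isLocallyContMDiff_leviCivita_holds ⊤ (le_of_eq rfl) univ isOpen_univ⟩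
  have hc : IsGeodesicallyComplete g.leviCivita :=
    isGeodesicallyComplete_of_isCompact_closedBall hg hcpl
  -- the Gram–Jacobian as a function on `T_pM`
  set Jac : EuclideanSpace ℝ (Fin m) → ℝ := fun w ↦ Real.sqrt (Matrix.det (Matrix.of
    fun i j : Fin m ↦ g.val (riemannianExpMap g p w)
      (mfderiv 𝓘(ℝ, EuclideanSpace ℝ (Fin m)) (𝓡 m)
        (fun u : EuclideanSpace ℝ (Fin m) ↦ riemannianExpMap g p u) w
        (EuclideanSpace.single i (1 : ℝ)))
      (mfderiv 𝓘(ℝ, EuclideanSpace ℝ (Fin m)) (𝓡 m)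
        (fun u : EuclideanSpace ℝ (Fin m) ↦ riemannianExpMap g p u) w
        (EuclideanSpace.single j (1 : ℝ)))))
  show AntitoneOn (fun s : ℝ ↦ Jac (s • v)) (Ioc (0 : ℝ) 1)
  by_cases hv0 : v = 0
  · intro s _ t _ _
    simp only [hv0, smul_zero, le_refl]
  -- the unit-speed reparametrisation `u = v / |v|_g`, minimizing up to `ℓ = |v|_g`
  set ℓ := Real.sqrt (g.val p v v)
  have hℓ : 0 < ℓ := Real.sqrt_pos.2 (hg p v hv0)
  have hvv : g.val p v v = ℓ ^ 2 := (Real.sq_sqrt (hg p v hv0).le).symm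
  set u : EuclideanSpace ℝ (Fin m) := ℓ⁻¹ • v with hu_def
  have hu : g.val p u u = 1 := by
    have h1 : g.val p (ℓ⁻¹ • (show TangentSpace (𝓡 m) p from v))
        (ℓ⁻¹ • (show TangentSpace (𝓡 m) p from v)) = ℓ⁻¹ * (ℓ⁻¹ * g.val p v v) := by
      rw [map_smul, map_smul, FunLike.coe_smul, Pi.smul_apply]
      rfl
    have h2 : g.val p u u = ℓ⁻¹ * (ℓ⁻¹ * g.val p v v) := h1
    rw [h2, hvv]
    field_simp
  have hmin : IsMinimizingUpTo g hg p u ℓ := by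
    have h := (isMinimizingUpTo_smul_iff hg hc p v (inv_pos.2 hℓ) ℓ).2
    rw [inv_mul_cancel₀ hℓ.ne'] at h
    exact h hv
  have hsv : ∀ s : ℝ, s • v = (s * ℓ) • u := fun s ↦ by
    rw [hu_def, smul_smul, mul_assoc, mul_inv_cancel₀ hℓ.ne', mul_one]
  -- Bishop along `γ_u`, on the standard basis
  set b := (EuclideanSpace.basisFun (Fin m) ℝ).toBasis with hb
  have hb_apply : ∀ i, b i = EuclideanSpace.single i 1 := fun i ↦ by
    rw [hb, OrthonormalBasis.coe_toBasis, EuclideanSpace.basisFun_apply]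
  have hmain := antitoneOn_sqrt_det_gram_mfderiv_expMap_of_unit g hg hc
    (fun x w ↦ hRic x w) p u hu hℓ hmin b
  intro s hs t ht hst
  have hs' : s * ℓ ∈ Ioc 0 ℓ := ⟨mul_pos hs.1 hℓ, mul_le_of_le_one_left hℓ.le hs.2⟩
  have ht' : t * ℓ ∈ Ioc 0 ℓ := ⟨mul_pos ht.1 hℓ, mul_le_of_le_one_left hℓ.le ht.2⟩
  have key := hmain hs' ht' (mul_le_mul_of_nonneg_right hst hℓ.le)
  simp only [hb_apply] at key
  show Jac (t • v) ≤ Jac (s • v)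
  rw [hsv t, hsv s]
  exact key

end Main

end Literature.Geometry.Riemannian

end
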